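import Summits.QuantumFields.BalabanUV.Beta.SecondOrderContactAssembly

/-!
# `BalabanUV.Beta.SecondOrderSymContact` — binder row D1, W-side (L4): the SYMMETRISED form of the assembled second-order identity (the shape the
# hR END with remainder `SpineRecursiveRemainder.…_closed_bcj_rem` consumes for the W-literal `W2SymOfK …`), and the tadpole-nullity of the
# `conjV`-part of the remainder under the relative-inverse rules (β sub-cell, row BETA-an2 = BINDER-OWNERS row D1 OWNER, lineage an2 gen 17)

HONEST FRAMING (cell charter, verbatim): «discharging BetaPertH makes Balaban's UV stability UNCONDITIONAL — a real
constructive-QFT result; it is NOT the continuum limit and NOT the Clay problem.»  HONEST DEPENDENCY (verbatim): «continuum YM on T⁴ ⇐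
BetaPertH ∧ nine spine estimates (0/9 proved); BetaPertH ⇐ (D1) ∧ (D4) ∧ CAP+tail; G-an2-4 gates asym, D1 and NE2/3/4.»  DERIVED cell leaf:
[folklore] kernel algebra; no statement of Bałaban's papers is typed here, no `[cite:]` tag, no `def`, no `Prop` fact; instantiates NO binder
of the wall.  NOT D1, NOT `BetaPertH`, NOT continuum, NOT Clay.

## What

* `sym_of_split`: if `A₁ = W₁ + conjW 𝕄 V V′ (diagK G) (diagK G′) (diagK H₁) + D₁` and `A₂ = W₂ + conjW 𝕄 V′ V (diagK G′) (diagK G) (diagK H₂) + D₂` then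
  `½•(A₁ + A₂) = ½•(W₁ + W₂) + conjW 𝕄 V V′ (diagK G) (diagK G′) (diagK H₁) + (½•conjV 𝕄 (diagK (H₂ − H₁)) + ½•(D₁ + D₂))` — the swap symmetry of
  `conjW` (`conjW_swap`) and its affinity in the second symbol (`conjW_diag_symbol_add`).
* **`W2SymOfK_sharp_split_of`**: hence, from the two orientations of `SecondOrderContactAssembly.W2OfK_sharp_split` (taken as hypotheses `h₁`, `h₂`),
  `W2SymOfK K N S♯ M S₂♯ M₂♯ b c = W2SymOfK K N S M S₂ M₂ b c + conjW 𝕄 (dM b) (dM c) (diagK (G b)) (diagK (G c)) (diagK (X₂⋆ b c)) + Rm b c`,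
  **`Rm b c := ½•conjV 𝕄 (diagK (X₂⋆ c b − X₂⋆ b c)) + ½•(Δ b c + Δ c b)`** — exactly the (hWrC-rem) shape of the END.
* `tadpole_conjV_rel_eq_zero`: `tadpole A (conjV 𝕄 Y) = 0` under `RelInv A 𝕄 E` for a localised `Y` commuting with `E` (an2-g12's trace rules
  `trace_KHY_rel`/`trace_KYH_rel`); `tadpole_rem_eq_zero`: so the remainder's tadpole is `½ (tadpole A (Δ b c) + tadpole A (Δ c b))`, zero when both
  residual tadpoles are (leaf-05's `SpineRecursiveParity.tadpole_dM_eq_zero_of_rows`).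
Provenance: β sub-cell, unit beta-an2 gen 17, 2026-08-20 (v1); BY NAME over `SecondOrderContactAssembly`, an5's `ChartConjugation`/`TameKernelCalculus`,
an2-g12's `ChartConjugationRelative`; no existing file touched.
-/

noncomputable section

open Finset
open scoped BigOperators
open Literature.MathematicalPhysics.QuantumFieldTheory
open Literature.MathematicalPhysics.QuantumFieldTheory.Balaban1983to89
open Literature.MathematicalPhysics.QuantumFieldTheory.Balaban1983to89.Beta
open ExpKernelCalculus (MKer comp tr tadpole)
open OneStepResolventKernel (Fib)
open SecondOrderResponse (dM K2OfK W2OfK W2SymOfK)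
open Summit.QuantumFields.BalabanUV.Beta.TameKernelCalculus (Spr Loc Tame tadpole_add tr_sub_loc comp_sub_right_tame)
open Summit.QuantumFields.BalabanUV.Beta.ChartConjugation (conjV conjW loc_conjV)
open Summit.QuantumFields.BalabanUV.Beta.ChartConjugationRelative (RelInv trace_KHY_rel trace_KYH_rel)
open Summit.QuantumFields.BalabanUV.Beta.BorderedHessian (diagK)
open Summit.QuantumFields.BalabanUV.Beta.SecondOrderContactForm (conjW_swap conjW_diag_symbol_add)

namespace Summit.QuantumFields.BalabanUV.Beta.SecondOrderSymContact

variable {d : ℕ}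

/-! ## §1 Symmetrising a split -/

/-- [folklore] **SYMMETRISING THE TWO ORIENTATIONS OF A SPLIT.** -/
theorem sym_of_split {𝕄 V Vp A₁ A₂ W₁ W₂ D₁ D₂ : MKer (d + 1) (Fib d)} {G G' H₁ H₂ : (Fin (d + 1) → ℤ) → Fib d → ℝ}
    (h₁ : A₁ = W₁ + conjW 𝕄 V Vp (diagK G) (diagK G') (diagK H₁) + D₁)
    (h₂ : A₂ = W₂ + conjW 𝕄 Vp V (diagK G') (diagK G) (diagK H₂) + D₂) :
    (1 / 2 : ℝ) • (A₁ + A₂) =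
      (1 / 2 : ℝ) • (W₁ + W₂) + conjW 𝕄 V Vp (diagK G) (diagK G') (diagK H₁) +
        ((1 / 2 : ℝ) • conjV 𝕄 (diagK fun p a => H₂ p a - H₁ p a) + (1 / 2 : ℝ) • (D₁ + D₂)) := by
  have e : (diagK H₂ : MKer (d + 1) (Fib d)) = diagK fun p a => H₁ p a + (H₂ p a - H₁ p a) := by
    congr 1; funext p a; ring
  rw [h₁, h₂, conjW_swap 𝕄 Vp V, e, conjW_diag_symbol_add]
  module

/-! ## §2 The symmetrised second-order carrier -/

/-- [folklore] **THE SYMMETRISED ASSEMBLED IDENTITY, FROM ITS TWO ORIENTATIONS.**  With `h₁`, `h₂` the conclusions of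
`SecondOrderContactAssembly.W2OfK_sharp_split` at `(b, c)` and at `(c, b)` (any ♯-tables `Sg`, `S₂g`, `M₂g` — the lemma is agnostic of their shape),
`W2SymOfK K N Sg M S₂g M₂g b c = W2SymOfK K N S M S₂ M₂ b c + conjW 𝕄 (dM b) (dM c) (diagK Gb) (diagK Gc) (diagK X₁) + (½•conjV 𝕄 (diagK (X₂ − X₁)) + ½•(Δ₁ + Δ₂))`. -/
theorem W2SymOfK_sharp_split_of {K 𝕄 : MKer (d + 1) (Fib d)} {N : ℕ}
    {S Sg M : Fin (d + 1) → (Fin (d + 1) → ℤ) → MKer (d + 1) (Fib d)}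
    {S₂ S₂g M₂ M₂g : Fin (d + 1) → (Fin (d + 1) → ℤ) → Fin (d + 1) → (Fin (d + 1) → ℤ) → MKer (d + 1) (Fib d)}
    {μ : Fin (d + 1)} {y : Fin (d + 1) → ℤ} {ν : Fin (d + 1)} {y' : Fin (d + 1) → ℤ}
    {Gb Gc X₁ X₂ : (Fin (d + 1) → ℤ) → Fib d → ℝ} {Δ₁ Δ₂ : MKer (d + 1) (Fib d)}
    (h₁ : W2OfK K N Sg M S₂g M₂g μ y ν y' =
      W2OfK K N S M S₂ M₂ μ y ν y' + conjW 𝕄 (dM K N S M μ y) (dM K N S M ν y') (diagK Gb) (diagK Gc) (diagK X₁) + Δ₁)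
    (h₂ : W2OfK K N Sg M S₂g M₂g ν y' μ y =
      W2OfK K N S M S₂ M₂ ν y' μ y + conjW 𝕄 (dM K N S M ν y') (dM K N S M μ y) (diagK Gc) (diagK Gb) (diagK X₂) + Δ₂) :
    W2SymOfK K N Sg M S₂g M₂g μ y ν y' =
      W2SymOfK K N S M S₂ M₂ μ y ν y' + conjW 𝕄 (dM K N S M μ y) (dM K N S M ν y') (diagK Gb) (diagK Gc) (diagK X₁) +
        ((1 / 2 : ℝ) • conjV 𝕄 (diagK fun p a => X₂ p a - X₁ p a) + (1 / 2 : ℝ) • (Δ₁ + Δ₂)) := by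
  unfold SecondOrderResponse.W2SymOfK
  exact sym_of_split h₁ h₂

/-! ## §3 The `conjV`-part of the remainder has zero tadpole; the remainder's tadpole -/

section Tadpole

variable {D : ℕ} {F : Type*} [Fintype F]

/-- [folklore] **A FIRST-ORDER CONTACT HAS ZERO TADPOLE AGAINST A RELATIVE INVERSE**: `tadpole A (conjV 𝕄 Y) = tr (A∘𝕄∘Y) − tr (A∘Y∘𝕄) =
tr (E∘Y) − tr (E∘Y) = 0` (an2-g12's `trace_KHY_rel` / `trace_KYH_rel`; `Y` localised, commuting with `E`). -/
theorem tadpole_conjV_rel_eq_zero {A M E Y : MKer D F} (hA : Spr A) (hM : Spr M) (hE : Spr E) (hR : RelInv A M E) (hY : Loc Y)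
    (hEY : comp E Y = comp Y E) : tadpole A (conjV M Y) = 0 := by
  unfold ExpKernelCalculus.tadpole ChartConjugation.conjV
  rw [comp_sub_right_tame hA.tame (hM.comp_loc hY).tame (hY.comp_spr hM).tame,
    tr_sub_loc (hA.comp_loc (hM.comp_loc hY)) (hA.comp_loc (hY.comp_spr hM)), trace_KHY_rel hA hM hE hR hY hEY,
    trace_KYH_rel hA hM hE hR hY hEY, sub_self]

/-- [folklore] **THE TADPOLE OF THE REMAINDER** `½•C + ½•(Δ₁ + Δ₂)` with `tadpole A C = 0`: `= ½ (tadpole A Δ₁ + tadpole A Δ₂)`. -/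
theorem tadpole_rem_eq {A C Δ₁ Δ₂ : MKer D F} (hA : Spr A) (hC : Loc C) (h₁ : Loc Δ₁) (h₂ : Loc Δ₂) (hC0 : tadpole A C = 0) :
    tadpole A ((1 / 2 : ℝ) • C + (1 / 2 : ℝ) • (Δ₁ + Δ₂)) = (1 / 2 : ℝ) * (tadpole A Δ₁ + tadpole A Δ₂) := by
  rw [tadpole_add hA (hC.smul _) ((h₁.add h₂).smul _), KernelReflection.tadpole_smul, KernelReflection.tadpole_smul, hC0, mul_zero, zero_add,
    tadpole_add hA h₁ h₂]

/-- [folklore] **… AND IT VANISHES WHEN BOTH RESIDUAL TADPOLES DO** (leaf-05's `SpineRecursiveParity.tadpole_dM_eq_zero_of_rows` for `Δ = dM (Ξ c) N S M b`). -/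
theorem tadpole_rem_eq_zero {A C Δ₁ Δ₂ : MKer D F} (hA : Spr A) (hC : Loc C) (h₁ : Loc Δ₁) (h₂ : Loc Δ₂) (hC0 : tadpole A C = 0)
    (hΔ₁ : tadpole A Δ₁ = 0) (hΔ₂ : tadpole A Δ₂ = 0) : tadpole A ((1 / 2 : ℝ) • C + (1 / 2 : ℝ) • (Δ₁ + Δ₂)) = 0 := by
  rw [tadpole_rem_eq hA hC h₁ h₂ hC0, hΔ₁, hΔ₂, add_zero, mul_zero]

omit [Fintype F] in
/-- [folklore] The remainder is localised when its three pieces are. -/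
theorem loc_rem {C Δ₁ Δ₂ : MKer D F} (hC : Loc C) (h₁ : Loc Δ₁) (h₂ : Loc Δ₂) :
    Loc ((1 / 2 : ℝ) • C + (1 / 2 : ℝ) • (Δ₁ + Δ₂)) := (hC.smul _).add ((h₁.add h₂).smul _)

end Tadpole

end Summit.QuantumFields.BalabanUV.Beta.SecondOrderSymContact

end
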